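import Summits.CriticalPhenomena.PercolationContinuityZ3.Theorems.PercNearOneGluingNoHeavyLowerTailAntitheticMonotoneCube
import Summits.CriticalPhenomena.PercolationContinuityZ3.Theorems.PercNearOneGluingNoHeavyLowerTailAntitheticSealing
import Summits.CriticalPhenomena.PercolationContinuityZ3.Theorems.PercNearOneGluingNoHeavyLowerTailAntitheticLatticePieces
import HarnessLib

/-!
# `NoHeavyLowerTail` (stmt-CriticalPhenomena-4575) — antithetic cluster pairs: BLOCK FREEZING and THEOREM OS⊕-A (the first one-sided term
# of deg-2 elimination is nonnegative on EVERY graph) (prim-hp-2 gen 56, HOME/THEOREM-OneSided.md Lemma 2 / Theorem OS⊕-A)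

Support file (`--supports stmt-CriticalPhenomena-4575`, hull-port prover `prim-hp-2`, gen 56).  No definitions, no named facts, no sorries;
standard axioms.  Vertex version (functions of the VERTEX clusters `openCluster`).

SETTING.  Colourings `ω ⊆ Sym2 V`; red edges `ω ∩ E`, blue edges `ωᶜ ∩ E`; `X(ω) = openCluster (ω ∩ E) s`, `Y(ω) = openCluster (ωᶜ ∩ E) s`.
Fix a vertex `y`.  BLOCK FREEZING (HOME/THEOREM-OneSided.md Lemma 2): for `ω` with `y ∉ X(ω)` let `Z` = the red cluster of `y`
(`s ∉ Z`), `B` = all pairs meeting `Z`; the colourings agreeing with `ω` on `B` form the PART of `ω`.  Parts partition `{y ∉ X}`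
(`Antithetic.Freeze.cluster_eq_of_agree`: a colouring agreeing on `B` has the same red cluster of `y`, by the sealing lemma twice), every
member still has `y ∉ X` (`Antithetic.Freeze.not_reach_of_agree`), and a part is a cube in the free pairs `Bᶜ` on which the red cluster
of `s` never enters `Z` (`Antithetic.Freeze.red_subset_blue_antipode`: it is contained in the blue cluster of the ANTIPODAL member) — a
BLUE-DOMINATED monotone cube in the sense of `Antithetic.monotone_cube_sum_nonneg`.

**THEOREM OS⊕-A** (`Antithetic.termOne_nonneg`).  For every finite edge set `E`, source `s`, vertices `y, z`, bonus set `A` and monotone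
vertex functions `F, G`:
`0 ≤ Σ_{ω : y ∉ X(ω)} (F(X ω) − F(Y ω ∪ A·[z ∈ Y ω]))·(G(X ω) − G(Y ω ∪ A·[z ∈ Y ω]))`.
With `A = {x}` this is TERM I of the deg-2 elimination at a degree-2 vertex `x` with neighbours `y, z` (HOME/THEOREM-OneSided.md Theorem
OS⊕-A/B): it is nonnegative on every graph, so CONJECTURE Δ2 at `x` reduces to the single one-sided inequality TERM II ≥ 0.
[cite: VandenbergHaggstromKahn2005, §1 p. 6 ("Harris' inequality"), §1 p. 3 (open cluster `C_s`)]
-/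

noncomputable section

namespace Summit.CriticalPhenomena.PercolationContinuityZ3.Theorems

open Literature.Probability.Percolation
open scoped Classical

namespace Antithetic

namespace Freeze

variable {V : Type*}

/-- Enlarging the open edge set enlarges open clusters. [folklore] -/
theorem openCluster_mono {ω ω' : Set (Sym2 V)} (h : ω ⊆ ω') (v : V) : openCluster ω v ⊆ openCluster ω' v := by
  intro u hu
  refine hu.mono ?_
  intro a b hab
  rw [openGraph_adj] at hab ⊢
  exact ⟨h hab.1, hab.2⟩

/-- A pair meeting a set meets it at one of its two entries. [folklore] -/
theorem mem_or_mem_of_meets {Z : Set V} {a b : V} (h : ∃ v ∈ Z, v ∈ s(a, b)) : a ∈ Z ∨ b ∈ Z := by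
  obtain ⟨v, hvZ, hv⟩ := h
  rcases Sym2.mem_iff.1 hv with rfl | rfl
  · exact Or.inl hvZ
  · exact Or.inr hvZ

/-- An open edge from a cluster leads into the cluster. [folklore] -/
theorem mem_cluster_of_edge {ω : Set (Sym2 V)} {y a b : V} (ha : a ∈ openCluster ω y) (hab : s(a, b) ∈ ω) :
    b ∈ openCluster ω y := by
  by_cases hne : a = b
  · rwa [← hne]
  · have hadj : (openGraph ω).Adj a b := by rw [openGraph_adj]; exact ⟨hab, hne⟩
    exact SimpleGraph.Reachable.trans ha hadj.reachable

variable (E : Set (Sym2 V)) (s y : V)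

/-- **Block freezing, invariance.**  If `M` agrees with `ω` on every pair meeting the red cluster `Z` of `y` in `ω`, then the red
cluster of `y` in `M` is again `Z` (sealing lemma in both directions). [this work] -/
theorem cluster_eq_of_agree (ω M : Set (Sym2 V))
    (hagree : ∀ e : Sym2 V, (∃ v ∈ openCluster (ω ∩ E) y, v ∈ e) → (e ∈ M ↔ e ∈ ω)) :
    openCluster (M ∩ E) y = openCluster (ω ∩ E) y := by
  set Z := openCluster (ω ∩ E) y with hZ
  have hyJ : y ∉ Zᶜ := fun h => h (mem_openCluster_self _ _)
  -- pairs inside `Z` agree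
  have hag : ∀ a b : V, a ∉ Zᶜ → b ∉ Zᶜ → (s(a, b) ∈ ω ∩ E ↔ s(a, b) ∈ M ∩ E) := by
    intro a b ha _
    have ha' : a ∈ Z := not_not.1 ha
    have := hagree s(a, b) ⟨a, ha', Sym2.mem_mk_left a b⟩
    exact ⟨fun h => ⟨this.2 h.1, h.2⟩, fun h => ⟨this.1 h.1, h.2⟩⟩
  -- no red `ω`-edge leaves `Z`
  have hsealω : ∀ a b : V, a ∉ Zᶜ → b ∈ Zᶜ → s(a, b) ∉ ω ∩ E := by
    intro a b ha hb h
    exact hb (mem_cluster_of_edge (not_not.1 ha) h)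
  -- hence no red `M`-edge leaves `Z`
  have hsealM : ∀ a b : V, a ∉ Zᶜ → b ∈ Zᶜ → s(a, b) ∉ M ∩ E := by
    intro a b ha hb h
    have ha' : a ∈ Z := not_not.1 ha
    have hω : s(a, b) ∈ ω := (hagree s(a, b) ⟨a, ha', Sym2.mem_mk_left a b⟩).1 h.1
    exact hsealω a b ha hb ⟨hω, h.2⟩
  apply Set.Subset.antisymm
  · intro v hv
    have := reachable_of_sealed (ω ∩ E) (M ∩ E) y Zᶜ hyJ (fun a b ha hb => (hag a b ha hb).symm) hsealM hv
    exact not_not.1 this.2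
  · intro v hv
    exact (reachable_of_sealed (M ∩ E) (ω ∩ E) y Zᶜ hyJ (fun a b ha hb => hag a b ha hb) hsealω hv).1

/-- **Block freezing, the event is preserved.**  If `s` is not in the red cluster `Z` of `y` in `ω` and `M` agrees with `ω` on the pairs
meeting `Z`, then `y` is not red-reachable from `s` in `M`. [this work] -/
theorem not_reach_of_agree (ω M : Set (Sym2 V)) (hs : s ∉ openCluster (ω ∩ E) y)
    (hagree : ∀ e : Sym2 V, (∃ v ∈ openCluster (ω ∩ E) y, v ∈ e) → (e ∈ M ↔ e ∈ ω)) :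
    ¬ (openGraph (M ∩ E)).Reachable s y := by
  intro h
  have hy : y ∈ openCluster (M ∩ E) y := mem_openCluster_self _ _
  rw [cluster_eq_of_agree E y ω M hagree] at hy
  -- `Z` is sealed in `M`: an `M`-red edge from outside into `Z` would be an `ω`-red edge
  have hseal : ∀ a b : V, a ∉ openCluster (ω ∩ E) y → b ∈ openCluster (ω ∩ E) y → s(a, b) ∉ M ∩ E := by
    intro a b ha hb hM
    have hω : s(a, b) ∈ ω := (hagree s(a, b) ⟨b, hb, Sym2.mem_mk_right a b⟩).1 hM.1
    exact ha (mem_cluster_of_edge hb (show s(b, a) ∈ ω ∩ E by rw [Sym2.eq_swap]; exact ⟨hω, hM.2⟩))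
  have := reachable_of_sealed (M ∩ E) (M ∩ E) s (openCluster (ω ∩ E) y) hs (fun _ _ _ _ => Iff.rfl) hseal h
  exact this.2 hy

/-- **Block freezing, domination.**  With `Z` the red cluster of `y` in `ω`, `s ∉ Z`, `N = ω` restricted to the pairs meeting `Z` and `S` a
set of pairs avoiding `Z`: the red cluster of `s` in the member `N ∪ S` does not enter `Z`, hence is contained in the blue cluster of `s`
in any colouring whose blue edges contain `S ∩ E` — in particular in the antipodal member. [this work] -/
theorem red_subset_of_free (ω : Set (Sym2 V)) (hs : s ∉ openCluster (ω ∩ E) y) (S : Set (Sym2 V))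
    (hS : ∀ e ∈ S, ¬ ∃ v ∈ openCluster (ω ∩ E) y, v ∈ e) :
    openCluster (({e | e ∈ ω ∧ ∃ v ∈ openCluster (ω ∩ E) y, v ∈ e} ∪ S) ∩ E) s ⊆ openCluster (S ∩ E) s := by
  set Z := openCluster (ω ∩ E) y with hZ
  intro v hv
  refine (reachable_of_sealed (S ∩ E) (({e | e ∈ ω ∧ ∃ v ∈ Z, v ∈ e} ∪ S) ∩ E) s Z hs ?_ ?_ hv).1
  · -- pairs with both entries outside `Z` do not meet `Z`
    intro a b ha hb
    constructor
    · rintro ⟨hab | hab, he⟩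
      · exact absurd (mem_or_mem_of_meets hab.2) (not_or.2 ⟨ha, hb⟩)
      · exact ⟨hab, he⟩
    · rintro ⟨hab, he⟩
      exact ⟨Or.inr hab, he⟩
  · -- no red edge of the member enters `Z`: boundary pairs are blue in `ω` and not in `S`
    intro a b ha hb h
    rcases h with ⟨hab | hab, he⟩
    · exact ha (mem_cluster_of_edge hb (show s(b, a) ∈ ω ∩ E by rw [Sym2.eq_swap]; exact ⟨hab.1, he⟩))
    · exact hS _ hab ⟨b, hb, Sym2.mem_mk_right a b⟩

end Freeze

section TermOne

variable {V : Type*} [Fintype V]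

open Freeze in
/-- **THEOREM OS⊕-A** (HOME/THEOREM-OneSided.md): for every finite edge set `E`, source `s`, vertices `y, z`, bonus set `A` and monotone
vertex functions `F, G`, the antithetic sum over the one-sided event `{y ∉ X}` with the blue cluster enlarged by `A` whenever it
contains `z` is nonnegative:
`0 ≤ Σ_{ω : y ∉ X(ω)} (F(X ω) − F(Y ω ∪ A·[z ∈ Y ω]))(G(X ω) − G(Y ω ∪ A·[z ∈ Y ω]))`.
(TERM I of deg-2 elimination, with `A = {x}`.)  Proof: block freezing partitions the event into blue-dominated monotone cubes;
`monotone_cube_sum_nonneg` on each; partition principle. [this work] -/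
theorem termOne_nonneg (E : Set (Sym2 V)) (s y z : V) (A : Set V) {F G : Set V → ℝ} (hF : Monotone F) (hG : Monotone G) :
    0 ≤ ∑ ω ∈ Finset.univ.filter (fun ω : Set (Sym2 V) => ¬ (openGraph (ω ∩ E)).Reachable s y),
      (F (openCluster (ω ∩ E) s) - F (openCluster (ωᶜ ∩ E) s ∪ {v | v ∈ A ∧ z ∈ openCluster (ωᶜ ∩ E) s})) *
        (G (openCluster (ω ∩ E) s) - G (openCluster (ωᶜ ∩ E) s ∪ {v | v ∈ A ∧ z ∈ openCluster (ωᶜ ∩ E) s})) := by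
  -- notation
  let X : Set (Sym2 V) → Set V := fun ω => openCluster (ω ∩ E) s
  let Yb : Set (Sym2 V) → Set V := fun ω => openCluster (ωᶜ ∩ E) s ∪ {v | v ∈ A ∧ z ∈ openCluster (ωᶜ ∩ E) s}
  let Ψ : Set (Sym2 V) → ℝ := fun ω => (F (X ω) - F (Yb ω)) * (G (X ω) - G (Yb ω))
  let Zc : Set (Sym2 V) → Set V := fun ω => openCluster (ω ∩ E) y
  let meets : Set (Sym2 V) → Sym2 V → Prop := fun ω e => ∃ v ∈ Zc ω, v ∈ e
  let P : Set (Sym2 V) → Finset (Set (Sym2 V)) := fun ω =>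
    Finset.univ.filter fun M => ∀ e, meets ω e → (e ∈ M ↔ e ∈ ω)
  let D : Finset (Set (Sym2 V)) := Finset.univ.filter fun ω => ¬ (openGraph (ω ∩ E)).Reachable s y
  show 0 ≤ ∑ ω ∈ D, Ψ ω
  -- monotonicity of the two cluster maps
  have hXmono : Monotone X := fun ω ω' h => openCluster_mono (Set.inter_subset_inter_left E h) s
  have hYanti : Antitone Yb := by
    intro ω ω' h
    have h1 : openCluster (ω'ᶜ ∩ E) s ⊆ openCluster (ωᶜ ∩ E) s :=
      openCluster_mono (Set.inter_subset_inter_left E (Set.compl_subset_compl.2 h)) s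
    exact Set.union_subset_union h1 (fun v hv => ⟨hv.1, h1 hv.2⟩)
  have hsD : ∀ ω ∈ D, s ∉ Zc ω := by
    intro ω hω hsZ
    exact (Finset.mem_filter.1 hω).2 (SimpleGraph.Reachable.symm hsZ)
  refine sum_nonneg_of_parts D Ψ P ?_ ?_ ?_ ?_
  · -- ω ∈ P ω
    intro ω _
    exact Finset.mem_filter.2 ⟨Finset.mem_univ _, fun e _ => Iff.rfl⟩
  · -- P ω ⊆ D
    intro ω hω M hM
    have hag := (Finset.mem_filter.1 hM).2
    exact Finset.mem_filter.2 ⟨Finset.mem_univ _, not_reach_of_agree E s y ω M (hsD ω hω) hag⟩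
  · -- parts are constant on themselves
    intro ω _ M hM
    have hag := (Finset.mem_filter.1 hM).2
    have hZ : Zc M = Zc ω := cluster_eq_of_agree E y ω M hag
    ext M'
    simp only [P, Finset.mem_filter, Finset.mem_univ, true_and, meets]
    rw [hZ]
    constructor
    · intro h e he; rw [← hag e he]; exact h e he
    · intro h e he; rw [hag e he]; exact h e he
  · -- each part has nonnegative sum: it is a blue-dominated monotone cube over the free pairs
    intro ω hω
    have hs : s ∉ Zc ω := hsD ω hω
    let ι := {e : Sym2 V // ¬ meets ω e}
    let N : Set (Sym2 V) := {e | e ∈ ω ∧ meets ω e}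
    let emb : Set ι → Set (Sym2 V) := fun S => N ∪ {e | ∃ h : ¬ meets ω e, (⟨e, h⟩ : ι) ∈ S}
    let proj : Set (Sym2 V) → Set ι := fun M => {p | p.1 ∈ M}
    have hemb_mono : Monotone emb := by
      intro S S' h e he
      rcases he with he | ⟨hne, hmem⟩
      · exact Or.inl he
      · exact Or.inr ⟨hne, h hmem⟩
    -- the free part of a member avoids `Z`
    have hfree : ∀ S : Set ι, ∀ e ∈ {e : Sym2 V | ∃ h : ¬ meets ω e, (⟨e, h⟩ : ι) ∈ S}, ¬ meets ω e :=
      fun S e he => he.1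
    -- complement of a member, off the block, is the free part of the antipode
    have hcompl : ∀ S : Set ι, {e : Sym2 V | ∃ h : ¬ meets ω e, (⟨e, h⟩ : ι) ∈ Sᶜ} ⊆ (emb S)ᶜ := by
      intro S e he hmem
      obtain ⟨hne, hS⟩ := he
      rcases hmem with hN | ⟨hne', hS'⟩
      · exact hne hN.2
      · exact hS hS'
    -- blue domination: red cluster of a member ⊆ blue cluster of the antipodal member
    have hdom : ∀ S : Set ι, X (emb S) ⊆ Yb (emb Sᶜ) := by
      intro S v hv
      have h1 : v ∈ openCluster ({e : Sym2 V | ∃ h : ¬ meets ω e, (⟨e, h⟩ : ι) ∈ S} ∩ E) s :=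
        red_subset_of_free E s y ω hs _ (hfree S) hv
      have hSS : {e : Sym2 V | ∃ h : ¬ meets ω e, (⟨e, h⟩ : ι) ∈ S} ⊆ (emb Sᶜ)ᶜ := by
        have := hcompl Sᶜ
        rw [compl_compl] at this
        exact this
      exact Or.inl (openCluster_mono (Set.inter_subset_inter_left E hSS) s h1)
    have hcube := monotone_cube_sum_nonneg (fun S : Set ι => X (emb S)) (fun S : Set ι => Yb (emb S))
      (fun S S' h => hXmono (hemb_mono h)) (fun S S' h => hYanti (hemb_mono h)) (Or.inr hdom) hF hG
    -- transport the cube sum to the part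
    have hbij : ∑ S : Set ι, Ψ (emb S) = ∑ M ∈ P ω, Ψ M := by
      refine Finset.sum_nbij' emb proj ?_ ?_ ?_ ?_ ?_
      · intro S _
        refine Finset.mem_filter.2 ⟨Finset.mem_univ _, fun e he => ?_⟩
        constructor
        · rintro (hN | ⟨hne, _⟩)
          · exact hN.1
          · exact absurd he hne
        · exact fun heω => Or.inl ⟨heω, he⟩
      · intro M _; exact Finset.mem_univ _
      · intro S _
        ext p
        simp only [proj, emb, Set.mem_setOf_eq, Set.mem_union]
        constructor
        · rintro (hN | ⟨_, hp⟩)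
          · exact absurd hN.2 p.2
          · exact hp
        · exact fun hp => Or.inr ⟨p.2, hp⟩
      · intro M hM
        have hag := (Finset.mem_filter.1 hM).2
        ext e
        simp only [proj, emb, N, Set.mem_setOf_eq, Set.mem_union]
        constructor
        · rintro (⟨heω, he⟩ | ⟨_, hp⟩)
          · exact (hag e he).2 heω
          · exact hp
        · intro heM
          by_cases he : meets ω e
          · exact Or.inl ⟨(hag e he).1 heM, he⟩
          · exact Or.inr ⟨he, heM⟩
      · intro S _; rfl
    rw [← hbij]
    exact hcube

end TermOne

end Antithetic

end Summit.CriticalPhenomena.PercolationContinuityZ3.Theorems
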